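import Summits.NavierStokesRegularity.NavierStokesRegularity.Theorems.HardyPointSinkHardyEnergyBoundLedgerCutoff
import HarnessLib

/-!
# Route HardyPointSink — `HardyEnergyBound`, ledger stub: the integrands of one time slice

Helper file 2/5 for the glue stub `stub_hardyLedger_of` (item stmt-NavierStokesRegularity-7979, line
`birth`). For one time slice — a continuous velocity field `w`, a pressure field `q` and the
plateau cut-off `φ` of `…LedgerCutoff` seen from a sink `x₀ ∈ B(xs, R/4)` — it names the four
integrands of the localised point-sink identity,

* `A = ν|w|²(Δφ/r − 2Dφ(x−x₀)/r³)` (cut-off / annulus term),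
* `B_q = (|w|² + 2q) Dφ(w)/r` (cut-off transport–pressure term),
* `C_q = 2φ(|w|²/2 + q)⟨w, x−x₀⟩/r³` (weighted head flux),
* `flux_q = (|w|²/2 + q)⟨w, x−x₀⟩/r³` (sharp head flux), `r = |x − x₀|`,

and proves their pointwise bounds (the derivative terms live on the annulus where `r ≥ R/4`),
measurability and integrability.
-/

noncomputable section

open MeasureTheory Set Filter Topology Metric Function
open scoped ENNReal NNReal InnerProductSpace Laplacian

set_option linter.dupNamespace false -- nested layout Summit.<S>.<Sub>, Sub = S (D-0017)

namespace Summit.NavierStokesRegularity.NavierStokesRegularity.Theorems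

open Literature.Analysis.FluidPDE Literature.Analysis.PDE


/-! ### The integrands -/

/-- The annulus term `A = ν|w|²(Δφ/r − 2Dφ(x−x₀)/r³)`. -/
def hardyEnergyBound_ledgerA (ν : ℝ) (φ : (EuclideanSpace ℝ (Fin 3)) → ℝ) (w : (EuclideanSpace ℝ (Fin 3)) → (EuclideanSpace ℝ (Fin 3))) (x₀ x : (EuclideanSpace ℝ (Fin 3))) : ℝ :=
  ν * ‖w x‖ ^ 2 * ((Δ φ) x / ‖x - x₀‖ - 2 * fderiv ℝ φ x (x - x₀) / ‖x - x₀‖ ^ 3)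

/-- The transport–pressure cut-off term `B_q = (|w|² + 2q) Dφ(w)/r`. -/
def hardyEnergyBound_ledgerB (φ : (EuclideanSpace ℝ (Fin 3)) → ℝ) (w : (EuclideanSpace ℝ (Fin 3)) → (EuclideanSpace ℝ (Fin 3))) (q : (EuclideanSpace ℝ (Fin 3)) → ℝ) (x₀ x : (EuclideanSpace ℝ (Fin 3))) : ℝ :=
  (‖w x‖ ^ 2 + 2 * q x) * fderiv ℝ φ x (w x) / ‖x - x₀‖

/-- The weighted head flux `C_q = 2φ(|w|²/2 + q)⟨w, x−x₀⟩/r³`. -/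
def hardyEnergyBound_ledgerC (φ : (EuclideanSpace ℝ (Fin 3)) → ℝ) (w : (EuclideanSpace ℝ (Fin 3)) → (EuclideanSpace ℝ (Fin 3))) (q : (EuclideanSpace ℝ (Fin 3)) → ℝ) (x₀ x : (EuclideanSpace ℝ (Fin 3))) : ℝ :=
  2 * φ x * (‖w x‖ ^ 2 / 2 + q x) * inner ℝ (w x) (x - x₀) / ‖x - x₀‖ ^ 3

/-- The sharp head flux `flux_q = (|w|²/2 + q)⟨w, x−x₀⟩/r³`. -/
def hardyEnergyBound_ledgerFlux (w : (EuclideanSpace ℝ (Fin 3)) → (EuclideanSpace ℝ (Fin 3))) (q : (EuclideanSpace ℝ (Fin 3)) → ℝ) (x₀ x : (EuclideanSpace ℝ (Fin 3))) : ℝ :=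
  (‖w x‖ ^ 2 / 2 + q x) * inner ℝ (w x) (x - x₀) / ‖x - x₀‖ ^ 3

/-! ### Two elementary kernel bounds -/

/-- `|⟨a, x − x₀⟩/r³| ≤ |a| r⁻²` (with the junk conventions at `x = x₀`). -/
theorem hardyEnergyBound_ledger_abs_inner_div_cube_le (a x x₀ : (EuclideanSpace ℝ (Fin 3))) :
    |inner ℝ a (x - x₀) / ‖x - x₀‖ ^ 3| ≤ ‖a‖ * (‖x - x₀‖ ^ 2)⁻¹ := by
  rcases eq_or_ne (‖x - x₀‖) 0 with h0 | h0
  · rw [h0]; simp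
  · have hr : 0 < ‖x - x₀‖ := lt_of_le_of_ne (norm_nonneg _) (Ne.symm h0)
    rw [abs_div, abs_of_nonneg (by positivity : (0 : ℝ) ≤ ‖x - x₀‖ ^ 3), div_le_iff₀ (by positivity)]
    calc |inner ℝ a (x - x₀)| ≤ ‖a‖ * ‖x - x₀‖ := abs_real_inner_le_norm _ _
      _ = ‖a‖ * (‖x - x₀‖ ^ 2)⁻¹ * ‖x - x₀‖ ^ 3 := by field_simp

/-- `|(φ − 1)⟨a, x − x₀⟩/r³| ≤ (16/R²)|a|` for the plateau cut-off and a sink `x₀ ∈ B(xs, R/4)`. -/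
theorem hardyEnergyBound_ledger_abs_sub_one_mul_inner_div_le {xs x₀ : (EuclideanSpace ℝ (Fin 3))} {R : ℝ} (hR : 0 < R)
    (hx₀ : x₀ ∈ ball xs (R / 4)) (a x : (EuclideanSpace ℝ (Fin 3))) :
    |(hardyEnergyBound_ledger_cutoff xs hR x - 1) * (inner ℝ a (x - x₀) / ‖x - x₀‖ ^ 3)| ≤
      16 / R ^ 2 * ‖a‖ := by
  by_cases h1 : hardyEnergyBound_ledger_cutoff xs hR x = 1
  · rw [h1, sub_self, zero_mul, abs_zero]; positivity
  · have hr := hardyEnergyBound_ledger_quarter_le hx₀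
      (hardyEnergyBound_ledger_lt_dist_of_cutoff_ne_one xs hR h1).le
    rw [abs_mul]
    calc |hardyEnergyBound_ledger_cutoff xs hR x - 1| * |inner ℝ a (x - x₀) / ‖x - x₀‖ ^ 3|
        ≤ 1 * (‖a‖ * (‖x - x₀‖ ^ 2)⁻¹) :=
          mul_le_mul (hardyEnergyBound_ledger_cutoff_abs_sub_one_le xs hR x)
            (hardyEnergyBound_ledger_abs_inner_div_cube_le a x x₀) (abs_nonneg _) zero_le_one
      _ ≤ 1 * (‖a‖ * (16 / R ^ 2)) := by
          gcongr
          exact hardyEnergyBound_ledger_inv_sq_le hR hr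
      _ = 16 / R ^ 2 * ‖a‖ := by ring

section Slice

variable {xs x₀ : (EuclideanSpace ℝ (Fin 3))} {R : ℝ} (hR : 0 < R) (hx₀ : x₀ ∈ ball xs (R / 4))
variable {L₁ L₂ : ℝ} (hL₁0 : 0 ≤ L₁) (hL₂0 : 0 ≤ L₂)
  (hL₁ : ∀ x, ‖fderiv ℝ (hardyEnergyBound_ledger_cutoff xs hR) x‖ ≤ L₁)
  (hL₂ : ∀ x, |(Δ (hardyEnergyBound_ledger_cutoff xs hR)) x| ≤ L₂)

include hx₀

/-! ### Pointwise bounds for the cut-off derivative kernels -/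

include hL₂0 hL₂ in
/-- `|Δφ/r| ≤ 4L₂/R`. -/
theorem hardyEnergyBound_ledger_abs_laplacian_div_le (x : (EuclideanSpace ℝ (Fin 3))) :
    |(Δ (hardyEnergyBound_ledger_cutoff xs hR)) x / ‖x - x₀‖| ≤ L₂ * (4 / R) := by
  by_cases h0 : (Δ (hardyEnergyBound_ledger_cutoff xs hR)) x = 0
  · rw [h0, zero_div, abs_zero]; positivity
  · have hr := hardyEnergyBound_ledger_quarter_le hx₀
      (hardyEnergyBound_ledger_annulus_of_laplacian_ne_zero xs hR h0).1
    rw [abs_div, abs_of_nonneg (norm_nonneg _), div_eq_mul_inv]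
    exact mul_le_mul (hL₂ x) (hardyEnergyBound_ledger_inv_le hR hr) (inv_nonneg.2 (norm_nonneg _))
      hL₂0

include hL₁0 hL₁ in
/-- `|2Dφ(x − x₀)/r³| ≤ 32L₁/R²`. -/
theorem hardyEnergyBound_ledger_abs_fderiv_sub_div_le (x : (EuclideanSpace ℝ (Fin 3))) :
    |2 * fderiv ℝ (hardyEnergyBound_ledger_cutoff xs hR) x (x - x₀) / ‖x - x₀‖ ^ 3| ≤
      2 * L₁ * (16 / R ^ 2) := by
  by_cases h0 : fderiv ℝ (hardyEnergyBound_ledger_cutoff xs hR) x = 0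
  · rw [h0]; simp only [_root_.zero_apply, mul_zero, zero_div, abs_zero]; positivity
  · have hr := hardyEnergyBound_ledger_quarter_le hx₀
      (hardyEnergyBound_ledger_annulus_of_fderiv_ne_zero xs hR h0).1
    have hrpos : 0 < ‖x - x₀‖ := lt_of_lt_of_le (by positivity) hr
    have h1 : |fderiv ℝ (hardyEnergyBound_ledger_cutoff xs hR) x (x - x₀)| ≤ L₁ * ‖x - x₀‖ := by
      rw [← Real.norm_eq_abs]
      exact (ContinuousLinearMap.le_opNorm _ _).trans
        (mul_le_mul_of_nonneg_right (hL₁ x) (norm_nonneg _))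
    rw [abs_div, abs_mul, abs_two, abs_of_nonneg (by positivity : (0 : ℝ) ≤ ‖x - x₀‖ ^ 3)]
    calc 2 * |fderiv ℝ (hardyEnergyBound_ledger_cutoff xs hR) x (x - x₀)| / ‖x - x₀‖ ^ 3
        ≤ 2 * (L₁ * ‖x - x₀‖) / ‖x - x₀‖ ^ 3 := by gcongr
      _ = 2 * L₁ * (‖x - x₀‖ ^ 2)⁻¹ := by field_simp
      _ ≤ 2 * L₁ * (16 / R ^ 2) := by
          gcongr
          exact hardyEnergyBound_ledger_inv_sq_le hR hr

include hL₁0 hL₁ in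
/-- `|Dφ(a)/r| ≤ (4L₁/R)|a|`. -/
theorem hardyEnergyBound_ledger_abs_fderiv_apply_div_le (a x : (EuclideanSpace ℝ (Fin 3))) :
    |fderiv ℝ (hardyEnergyBound_ledger_cutoff xs hR) x a / ‖x - x₀‖| ≤ 4 * L₁ / R * ‖a‖ := by
  by_cases h0 : fderiv ℝ (hardyEnergyBound_ledger_cutoff xs hR) x = 0
  · rw [h0]; simp only [_root_.zero_apply, zero_div, abs_zero]; positivity
  · have hr := hardyEnergyBound_ledger_quarter_le hx₀
      (hardyEnergyBound_ledger_annulus_of_fderiv_ne_zero xs hR h0).1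
    have h1 : |fderiv ℝ (hardyEnergyBound_ledger_cutoff xs hR) x a| ≤ L₁ * ‖a‖ := by
      rw [← Real.norm_eq_abs]
      exact (ContinuousLinearMap.le_opNorm _ _).trans
        (mul_le_mul_of_nonneg_right (hL₁ x) (norm_nonneg _))
    rw [abs_div, abs_of_nonneg (norm_nonneg _), div_eq_mul_inv]
    calc |fderiv ℝ (hardyEnergyBound_ledger_cutoff xs hR) x a| * ‖x - x₀‖⁻¹
        ≤ (L₁ * ‖a‖) * (4 / R) :=
          mul_le_mul h1 (hardyEnergyBound_ledger_inv_le hR hr) (inv_nonneg.2 (norm_nonneg _))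
            (by positivity)
      _ = 4 * L₁ / R * ‖a‖ := by ring

/-! ### Pointwise bounds for the four integrands -/

include hL₁0 hL₂0 hL₁ hL₂ in
/-- `|A| ≤ |ν|(4L₂/R + 32L₁/R²)|w|²`. -/
theorem hardyEnergyBound_ledger_abs_ledgerA_le (ν : ℝ) (w : (EuclideanSpace ℝ (Fin 3)) → (EuclideanSpace ℝ (Fin 3))) (x : (EuclideanSpace ℝ (Fin 3))) :
    |hardyEnergyBound_ledgerA ν (hardyEnergyBound_ledger_cutoff xs hR) w x₀ x| ≤
      |ν| * (L₂ * (4 / R) + 2 * L₁ * (16 / R ^ 2)) * ‖w x‖ ^ 2 := by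
  unfold hardyEnergyBound_ledgerA
  rw [abs_mul, abs_mul, abs_of_nonneg (by positivity : (0 : ℝ) ≤ ‖w x‖ ^ 2)]
  have h := (abs_sub _ _).trans (add_le_add (hardyEnergyBound_ledger_abs_laplacian_div_le hR hx₀ hL₂0 hL₂ x)
    (hardyEnergyBound_ledger_abs_fderiv_sub_div_le hR hx₀ hL₁0 hL₁ x))
  calc |ν| * ‖w x‖ ^ 2 * |(Δ (hardyEnergyBound_ledger_cutoff xs hR)) x / ‖x - x₀‖ -
        2 * fderiv ℝ (hardyEnergyBound_ledger_cutoff xs hR) x (x - x₀) / ‖x - x₀‖ ^ 3|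
      ≤ |ν| * ‖w x‖ ^ 2 * (L₂ * (4 / R) + 2 * L₁ * (16 / R ^ 2)) := by gcongr
    _ = |ν| * (L₂ * (4 / R) + 2 * L₁ * (16 / R ^ 2)) * ‖w x‖ ^ 2 := by ring

omit hx₀ in
/-- `A` vanishes off the closed ball `B̄(xs, R)`. -/
theorem hardyEnergyBound_ledgerA_eq_zero (ν : ℝ) (w : (EuclideanSpace ℝ (Fin 3)) → (EuclideanSpace ℝ (Fin 3))) {x : (EuclideanSpace ℝ (Fin 3))} (hx : x ∉ closedBall xs R) :
    hardyEnergyBound_ledgerA ν (hardyEnergyBound_ledger_cutoff xs hR) w x₀ x = 0 := by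
  unfold hardyEnergyBound_ledgerA
  have h1 : (Δ (hardyEnergyBound_ledger_cutoff xs hR)) x = 0 := by
    by_contra h
    exact hx (mem_closedBall.2 (hardyEnergyBound_ledger_annulus_of_laplacian_ne_zero xs hR h).2)
  have h2 : fderiv ℝ (hardyEnergyBound_ledger_cutoff xs hR) x = 0 := by
    by_contra h
    exact hx (mem_closedBall.2 (hardyEnergyBound_ledger_annulus_of_fderiv_ne_zero xs hR h).2)
  rw [h1, h2]
  simp

include hL₁0 hL₁ in
/-- `|B_q| ≤ (4L₁/R)(|w|² + 2|q|)|w|`. -/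
theorem hardyEnergyBound_ledger_abs_ledgerB_le (w : (EuclideanSpace ℝ (Fin 3)) → (EuclideanSpace ℝ (Fin 3))) (q : (EuclideanSpace ℝ (Fin 3)) → ℝ) (x : (EuclideanSpace ℝ (Fin 3))) :
    |hardyEnergyBound_ledgerB (hardyEnergyBound_ledger_cutoff xs hR) w q x₀ x| ≤
      4 * L₁ / R * ((‖w x‖ ^ 2 + 2 * |q x|) * ‖w x‖) := by
  unfold hardyEnergyBound_ledgerB
  rw [mul_div_assoc, abs_mul]
  have h1 : |‖w x‖ ^ 2 + 2 * q x| ≤ ‖w x‖ ^ 2 + 2 * |q x| := by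
    refine (abs_add_le _ _).trans ?_
    rw [abs_of_nonneg (by positivity : (0 : ℝ) ≤ ‖w x‖ ^ 2), abs_mul, abs_two]
  calc |‖w x‖ ^ 2 + 2 * q x| *
        |fderiv ℝ (hardyEnergyBound_ledger_cutoff xs hR) x (w x) / ‖x - x₀‖|
      ≤ (‖w x‖ ^ 2 + 2 * |q x|) * (4 * L₁ / R * ‖w x‖) :=
        mul_le_mul h1 (hardyEnergyBound_ledger_abs_fderiv_apply_div_le hR hx₀ hL₁0 hL₁ (w x) x)
          (abs_nonneg _) (by positivity)
    _ = 4 * L₁ / R * ((‖w x‖ ^ 2 + 2 * |q x|) * ‖w x‖) := by ring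

omit hx₀ in
/-- `B_q` vanishes off the closed ball `B̄(xs, R)`. -/
theorem hardyEnergyBound_ledgerB_eq_zero (w : (EuclideanSpace ℝ (Fin 3)) → (EuclideanSpace ℝ (Fin 3))) (q : (EuclideanSpace ℝ (Fin 3)) → ℝ) {x : (EuclideanSpace ℝ (Fin 3))}
    (hx : x ∉ closedBall xs R) :
    hardyEnergyBound_ledgerB (hardyEnergyBound_ledger_cutoff xs hR) w q x₀ x = 0 := by
  unfold hardyEnergyBound_ledgerB
  have h2 : fderiv ℝ (hardyEnergyBound_ledger_cutoff xs hR) x = 0 := by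
    by_contra h
    exact hx (mem_closedBall.2 (hardyEnergyBound_ledger_annulus_of_fderiv_ne_zero xs hR h).2)
  rw [h2]
  simp

omit hx₀ in
/-- `|flux_q| ≤ (|w|²/2 + |q|)|w| r⁻²`. -/
theorem hardyEnergyBound_ledger_abs_ledgerFlux_le (w : (EuclideanSpace ℝ (Fin 3)) → (EuclideanSpace ℝ (Fin 3))) (q : (EuclideanSpace ℝ (Fin 3)) → ℝ) (x : (EuclideanSpace ℝ (Fin 3))) :
    |hardyEnergyBound_ledgerFlux w q x₀ x| ≤
      (‖w x‖ ^ 2 / 2 + |q x|) * ‖w x‖ * (‖x - x₀‖ ^ 2)⁻¹ := by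
  unfold hardyEnergyBound_ledgerFlux
  rw [mul_div_assoc, abs_mul]
  have h1 : |‖w x‖ ^ 2 / 2 + q x| ≤ ‖w x‖ ^ 2 / 2 + |q x| := by
    refine (abs_add_le _ _).trans ?_
    rw [abs_of_nonneg (by positivity : (0 : ℝ) ≤ ‖w x‖ ^ 2 / 2)]
  calc |‖w x‖ ^ 2 / 2 + q x| * |inner ℝ (w x) (x - x₀) / ‖x - x₀‖ ^ 3|
      ≤ (‖w x‖ ^ 2 / 2 + |q x|) * (‖w x‖ * (‖x - x₀‖ ^ 2)⁻¹) :=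
        mul_le_mul h1 (hardyEnergyBound_ledger_abs_inner_div_cube_le (w x) x x₀) (abs_nonneg _)
          (by positivity)
    _ = (‖w x‖ ^ 2 / 2 + |q x|) * ‖w x‖ * (‖x - x₀‖ ^ 2)⁻¹ := by ring

omit hx₀ in
/-- `C_q = 2 φ flux_q`. -/
theorem hardyEnergyBound_ledgerC_eq (w : (EuclideanSpace ℝ (Fin 3)) → (EuclideanSpace ℝ (Fin 3))) (q : (EuclideanSpace ℝ (Fin 3)) → ℝ) (x : (EuclideanSpace ℝ (Fin 3))) :
    hardyEnergyBound_ledgerC (hardyEnergyBound_ledger_cutoff xs hR) w q x₀ x =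
      2 * (hardyEnergyBound_ledger_cutoff xs hR x * hardyEnergyBound_ledgerFlux w q x₀ x) := by
  unfold hardyEnergyBound_ledgerC hardyEnergyBound_ledgerFlux
  ring

omit hx₀ in
/-- `|C_q| ≤ 2(|w|²/2 + |q|)|w| r⁻²`. -/
theorem hardyEnergyBound_ledger_abs_ledgerC_le (w : (EuclideanSpace ℝ (Fin 3)) → (EuclideanSpace ℝ (Fin 3))) (q : (EuclideanSpace ℝ (Fin 3)) → ℝ) (x : (EuclideanSpace ℝ (Fin 3))) :
    |hardyEnergyBound_ledgerC (hardyEnergyBound_ledger_cutoff xs hR) w q x₀ x| ≤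
      2 * ((‖w x‖ ^ 2 / 2 + |q x|) * ‖w x‖ * (‖x - x₀‖ ^ 2)⁻¹) := by
  rw [hardyEnergyBound_ledgerC_eq, abs_mul, abs_two, abs_mul]
  refine mul_le_mul_of_nonneg_left ?_ zero_le_two
  calc |hardyEnergyBound_ledger_cutoff xs hR x| * |hardyEnergyBound_ledgerFlux w q x₀ x|
      ≤ 1 * ((‖w x‖ ^ 2 / 2 + |q x|) * ‖w x‖ * (‖x - x₀‖ ^ 2)⁻¹) :=
        mul_le_mul (hardyEnergyBound_ledger_cutoff_abs_le_one xs hR x)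
          (hardyEnergyBound_ledger_abs_ledgerFlux_le w q x) (abs_nonneg _) zero_le_one
    _ = _ := one_mul _

omit hx₀ in
/-- `C_q` vanishes off the open ball `B(xs, R)`. -/
theorem hardyEnergyBound_ledgerC_eq_zero (w : (EuclideanSpace ℝ (Fin 3)) → (EuclideanSpace ℝ (Fin 3))) (q : (EuclideanSpace ℝ (Fin 3)) → ℝ) {x : (EuclideanSpace ℝ (Fin 3))} (hx : x ∉ ball xs R) :
    hardyEnergyBound_ledgerC (hardyEnergyBound_ledger_cutoff xs hR) w q x₀ x = 0 := by
  rw [hardyEnergyBound_ledgerC_eq]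
  have h0 : hardyEnergyBound_ledger_cutoff xs hR x = 0 := by
    by_contra h
    exact hx (hardyEnergyBound_ledger_mem_ball_of_cutoff_ne_zero xs hR h)
  rw [h0, zero_mul, mul_zero]

/-- `|(φ − 1) flux_q| ≤ (16/R²)(|w|²/2 + |q|)|w|`. -/
theorem hardyEnergyBound_ledger_abs_sub_one_mul_ledgerFlux_le (w : (EuclideanSpace ℝ (Fin 3)) → (EuclideanSpace ℝ (Fin 3))) (q : (EuclideanSpace ℝ (Fin 3)) → ℝ) (x : (EuclideanSpace ℝ (Fin 3))) :
    |(hardyEnergyBound_ledger_cutoff xs hR x - 1) * hardyEnergyBound_ledgerFlux w q x₀ x| ≤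
      16 / R ^ 2 * ((‖w x‖ ^ 2 / 2 + |q x|) * ‖w x‖) := by
  unfold hardyEnergyBound_ledgerFlux
  have e : (hardyEnergyBound_ledger_cutoff xs hR x - 1) *
      ((‖w x‖ ^ 2 / 2 + q x) * inner ℝ (w x) (x - x₀) / ‖x - x₀‖ ^ 3) =
      (‖w x‖ ^ 2 / 2 + q x) * ((hardyEnergyBound_ledger_cutoff xs hR x - 1) *
        (inner ℝ (w x) (x - x₀) / ‖x - x₀‖ ^ 3)) := by ring
  rw [e, abs_mul]
  have h1 : |‖w x‖ ^ 2 / 2 + q x| ≤ ‖w x‖ ^ 2 / 2 + |q x| := by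
    refine (abs_add_le _ _).trans ?_
    rw [abs_of_nonneg (by positivity : (0 : ℝ) ≤ ‖w x‖ ^ 2 / 2)]
  calc |‖w x‖ ^ 2 / 2 + q x| * |(hardyEnergyBound_ledger_cutoff xs hR x - 1) *
        (inner ℝ (w x) (x - x₀) / ‖x - x₀‖ ^ 3)|
      ≤ (‖w x‖ ^ 2 / 2 + |q x|) * (16 / R ^ 2 * ‖w x‖) :=
        mul_le_mul h1 (hardyEnergyBound_ledger_abs_sub_one_mul_inner_div_le hR hx₀ (w x) x)
          (abs_nonneg _) (by positivity)
    _ = 16 / R ^ 2 * ((‖w x‖ ^ 2 / 2 + |q x|) * ‖w x‖) := by ring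

omit hx₀ in
/-- `|φ⟨a, x − x₀⟩/r³| ≤ |a| r⁻²`, and it vanishes off `B(xs, R)`. -/
theorem hardyEnergyBound_ledger_abs_cutoff_mul_inner_div_le (a x : (EuclideanSpace ℝ (Fin 3))) :
    |hardyEnergyBound_ledger_cutoff xs hR x * inner ℝ a (x - x₀) / ‖x - x₀‖ ^ 3| ≤
      ‖a‖ * (‖x - x₀‖ ^ 2)⁻¹ := by
  rw [mul_div_assoc, abs_mul]
  calc |hardyEnergyBound_ledger_cutoff xs hR x| * |inner ℝ a (x - x₀) / ‖x - x₀‖ ^ 3|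
      ≤ 1 * (‖a‖ * (‖x - x₀‖ ^ 2)⁻¹) :=
        mul_le_mul (hardyEnergyBound_ledger_cutoff_abs_le_one xs hR x)
          (hardyEnergyBound_ledger_abs_inner_div_cube_le a x x₀) (abs_nonneg _) zero_le_one
    _ = _ := one_mul _

/-! ### Measurability -/

omit hx₀ in
/-- `A` is measurable for continuous `w`. -/
theorem hardyEnergyBound_ledger_measurable_ledgerA (ν : ℝ) {w : (EuclideanSpace ℝ (Fin 3)) → (EuclideanSpace ℝ (Fin 3))} (hw : Continuous w) :
    Measurable (hardyEnergyBound_ledgerA ν (hardyEnergyBound_ledger_cutoff xs hR) w x₀) := by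
  unfold hardyEnergyBound_ledgerA
  have h1 : Continuous fun x => (Δ (hardyEnergyBound_ledger_cutoff xs hR)) x :=
    hardyEnergyBound_ledger_continuous_laplacian_cutoff xs hR
  have h2 : Continuous fun x : (EuclideanSpace ℝ (Fin 3)) => fderiv ℝ (hardyEnergyBound_ledger_cutoff xs hR) x (x - x₀) :=
    (hardyEnergyBound_ledger_continuous_fderiv_cutoff xs hR).clm_apply
      (continuous_id.sub continuous_const)
  have h3 : Continuous fun x : (EuclideanSpace ℝ (Fin 3)) => ‖x - x₀‖ := (continuous_id.sub continuous_const).norm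
  exact ((continuous_const.mul (hw.norm.pow 2)).measurable).mul
    (((h1.measurable).div h3.measurable).sub
      ((continuous_const.mul h2).measurable.div (h3.pow 3).measurable))

omit hx₀ in
/-- `B_q` is a.e. strongly measurable for continuous `w` and measurable `q`. -/
theorem hardyEnergyBound_ledger_aestronglyMeasurable_ledgerB {w : (EuclideanSpace ℝ (Fin 3)) → (EuclideanSpace ℝ (Fin 3))} (hw : Continuous w)
    {q : (EuclideanSpace ℝ (Fin 3)) → ℝ} (hq : AEStronglyMeasurable q volume) :
    AEStronglyMeasurable (hardyEnergyBound_ledgerB (hardyEnergyBound_ledger_cutoff xs hR) w q x₀)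
      volume := by
  unfold hardyEnergyBound_ledgerB
  have h2 : Continuous fun x : (EuclideanSpace ℝ (Fin 3)) => fderiv ℝ (hardyEnergyBound_ledger_cutoff xs hR) x (w x) :=
    (hardyEnergyBound_ledger_continuous_fderiv_cutoff xs hR).clm_apply hw
  have h3 : Continuous fun x : (EuclideanSpace ℝ (Fin 3)) => ‖x - x₀‖ := (continuous_id.sub continuous_const).norm
  have h4 : AEStronglyMeasurable (fun x => ‖w x‖ ^ 2 + 2 * q x) volume :=
    (hw.norm.pow 2).aestronglyMeasurable.add (hq.const_mul 2)
  exact (h4.mul h2.aestronglyMeasurable).div₀ h3.aestronglyMeasurable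

omit hx₀ hR in
/-- `flux_q` is a.e. strongly measurable for continuous `w` and measurable `q`. -/
theorem hardyEnergyBound_ledger_aestronglyMeasurable_ledgerFlux {w : (EuclideanSpace ℝ (Fin 3)) → (EuclideanSpace ℝ (Fin 3))} (hw : Continuous w)
    {q : (EuclideanSpace ℝ (Fin 3)) → ℝ} (hq : AEStronglyMeasurable q volume) :
    AEStronglyMeasurable (hardyEnergyBound_ledgerFlux w q x₀) volume := by
  unfold hardyEnergyBound_ledgerFlux
  have h2 : Continuous fun x : (EuclideanSpace ℝ (Fin 3)) => inner ℝ (w x) (x - x₀) :=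
    hw.inner (continuous_id.sub continuous_const)
  have h3 : Continuous fun x : (EuclideanSpace ℝ (Fin 3)) => ‖x - x₀‖ ^ 3 := ((continuous_id.sub continuous_const).norm).pow 3
  have h4 : AEStronglyMeasurable (fun x => ‖w x‖ ^ 2 / 2 + q x) volume :=
    ((hw.norm.pow 2).div_const 2).aestronglyMeasurable.add hq
  exact (h4.mul h2.aestronglyMeasurable).div₀ h3.aestronglyMeasurable

omit hx₀ in
/-- `C_q` is a.e. strongly measurable for continuous `w` and measurable `q`. -/
theorem hardyEnergyBound_ledger_aestronglyMeasurable_ledgerC {w : (EuclideanSpace ℝ (Fin 3)) → (EuclideanSpace ℝ (Fin 3))} (hw : Continuous w)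
    {q : (EuclideanSpace ℝ (Fin 3)) → ℝ} (hq : AEStronglyMeasurable q volume) :
    AEStronglyMeasurable (hardyEnergyBound_ledgerC (hardyEnergyBound_ledger_cutoff xs hR) w q x₀)
      volume := by
  have e : hardyEnergyBound_ledgerC (hardyEnergyBound_ledger_cutoff xs hR) w q x₀ =
      fun x => 2 * (hardyEnergyBound_ledger_cutoff xs hR x * hardyEnergyBound_ledgerFlux w q x₀ x) :=
    funext fun x => hardyEnergyBound_ledgerC_eq hR w q x
  rw [e]
  exact (((hardyEnergyBound_ledger_cutoff_continuous xs hR).aestronglyMeasurable).mul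
    (hardyEnergyBound_ledger_aestronglyMeasurable_ledgerFlux hw hq)).const_mul 2

omit hx₀ in
/-- `x ↦ Dφ(w)/r` is measurable for continuous `w`. -/
theorem hardyEnergyBound_ledger_measurable_fderiv_apply_div {w : (EuclideanSpace ℝ (Fin 3)) → (EuclideanSpace ℝ (Fin 3))} (hw : Continuous w) :
    Measurable fun x => fderiv ℝ (hardyEnergyBound_ledger_cutoff xs hR) x (w x) / ‖x - x₀‖ :=
  (((hardyEnergyBound_ledger_continuous_fderiv_cutoff xs hR).clm_apply hw).measurable).div
    ((continuous_id.sub continuous_const).norm).measurable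

omit hx₀ in
/-- `x ↦ φ⟨w, x − x₀⟩/r³` is measurable for continuous `w`. -/
theorem hardyEnergyBound_ledger_measurable_cutoff_mul_inner_div {w : (EuclideanSpace ℝ (Fin 3)) → (EuclideanSpace ℝ (Fin 3))} (hw : Continuous w) :
    Measurable fun x =>
      hardyEnergyBound_ledger_cutoff xs hR x * inner ℝ (w x) (x - x₀) / ‖x - x₀‖ ^ 3 :=
  (((hardyEnergyBound_ledger_cutoff_continuous xs hR).mul
    (hw.inner (continuous_id.sub continuous_const))).measurable).div
    (((continuous_id.sub continuous_const).norm).pow 3).measurable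

end Slice

/-! ### Two integrability criteria -/

/-- A measurable function dominated on a measurable set by an integrable one is integrable there. -/
theorem hardyEnergyBound_ledger_integrableOn_of_bound {f g : (EuclideanSpace ℝ (Fin 3)) → ℝ} {K : Set (EuclideanSpace ℝ (Fin 3))}
    (hK : MeasurableSet K) (hf : AEStronglyMeasurable f volume) (hg : IntegrableOn g K)
    (hle : ∀ x ∈ K, |f x| ≤ g x) : IntegrableOn f K :=
  Integrable.mono' hg hf.restrict
    ((ae_restrict_iff' hK).2 (Eventually.of_forall fun x hx => by
      rw [Real.norm_eq_abs]; exact hle x hx))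

/-- A measurable function supported in a measurable set and dominated there by an integrable one is
integrable. -/
theorem hardyEnergyBound_ledger_integrable_of_supported {f g : (EuclideanSpace ℝ (Fin 3)) → ℝ} {K : Set (EuclideanSpace ℝ (Fin 3))}
    (hK : MeasurableSet K) (hf : AEStronglyMeasurable f volume) (hg : IntegrableOn g K)
    (hle : ∀ x ∈ K, |f x| ≤ g x) (h0 : ∀ x ∉ K, f x = 0) : Integrable f := by
  refine (integrableOn_iff_integrable_of_support_subset (fun x hx => ?_)).1
    (hardyEnergyBound_ledger_integrableOn_of_bound hK hf hg hle)
  by_contra h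
  exact hx (h0 x h)

/-- **Anchor of this helper file** (registered sub-goal of `stub_hardyLedger_of`): the kernel bound
`|⟨a, x − x₀⟩/r³| ≤ |a| r⁻²`. -/
theorem hardyEnergyBound_ledger_kernelBound :
    ∀ (a x b : EuclideanSpace ℝ (Fin 3)), |inner ℝ a (x - b) / ‖x - b‖ ^ 3| ≤ ‖a‖ * (‖x - b‖ ^ 2)⁻¹ :=
  hardyEnergyBound_ledger_abs_inner_div_cube_le

end Summit.NavierStokesRegularity.NavierStokesRegularity.Theorems

end
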